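import Literature.NumberTheory.Automorphic.LocalUnitaryGroupUnimodular
import Literature.NumberTheory.Automorphic.UnitaryGroupUnimodularAllRanks
import Literature.NumberTheory.Automorphic.UnitaryGroupTraceClasses
import HarnessLib

/-!
# The invariant measure on `U(H)(L⁺_v) ⧸ G_γ` carrying the LOCAL orbital integrals (Rogawski 1990 §4.9; Deitmar–Echterhoff,
# *Principles of Harmonic Analysis* (2014), Thm. 1.5.3)

Topic `NumberTheory/Automorphic`; namespace `Literature.NumberTheory.Automorphic` (§1, generic) and
`Literature.NumberTheory.Automorphic.UnitaryGroup` (§2).  THEOREMS ONLY (no definition, no instance, no named fact, no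
`sorry`).  Sequel of ★ `LocalUnitaryGroupCongrMeasure` (Haar measures on the local groups, F0P3a O2) and ★
`LocalUnitaryGroupUnimodular` (`U(H)(L⁺_v)` unimodular in rank `3`, O4); the measure-theoretic engine is the tree's ★
`Literature.MeasureTheory.Group.InvariantQuotientExistence` (`quotientMeasure`: Deitmar–Echterhoff Thm. 1.5.3, unimodular
case, with the quotient integral formula) and ★ `UnitaryGroupTraceClasses.exists_smulInvariantMeasure_quotient_of_isMulRightInvariant`.

The local orbital integral `Φ(γ, f_v) = ∫_{G_γ(L⁺_v) \ G(L⁺_v)} f_v(x⁻¹ γ x) dẋ` of [Rogawski1990, §4.9 p. 54] is an integral against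
a `G(L⁺_v)`-invariant Radon measure `dẋ` on the homogeneous space `G(L⁺_v) ⧸ G_γ(L⁺_v)`, `G_γ = ` the centraliser of `γ`; such a
measure exists iff `Δ_G|_{G_γ} = Δ_{G_γ}`, in particular when BOTH groups are unimodular (Deitmar–Echterhoff, Thm. 1.5.3).  This
file makes the measure PARAMETER of the local orbital integrals (F0-typ1 LETTER #3 `localOrbitalIntegral`, F0P3a-p07) EXIST:

* §1 (generic: `G` a locally compact, second countable, Hausdorff group, `γ ∈ G`): `isClosed_coe_centralizer_singleton`;
  `isMulRightInvariant_of_forall_comm` (a closed subgroup whose elements commute — e.g. the centraliser of a regular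
  semisimple element, a torus — is unimodular: every element is central, `Δ ≡ 1` by ★ `modularCharacter_eq_one_of_mem_center`);
  **`exists_smulInvariantMeasure_quotient_centralizer`**: for a Haar measure `ν` on `G` that is right invariant and a Haar
  measure `ρ` on `G_γ = Subgroup.centralizer {γ}` that is inversion invariant there is a `G`-invariant REGULAR (hence finite on
  compacts) measure `m ≠ 0` on `G ⧸ G_γ` with the quotient integral formula `∫_{G ⧸ G_γ} (∫_{G_γ} f(x h) dρ) dm = ∫_G f dν`
  (`f ∈ C_c(G)`); and `…_of_forall_comm` (abelian centraliser: no hypothesis on `ρ`).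
* §2 (CM field `L`, `H ∈ M₃(L)` hermitian with `det H ≠ 0`, `v` a finite place of `L⁺`, `G = U(H)(L⁺_v) = (cmDatum L 3 H).Local v`,
  unimodular by ★ O4): **`exists_localOrbitalMeasure`** (for EVERY Haar `ν` on `G` and every inversion-invariant Haar `ρ` on
  `G_γ`: a `G`-invariant regular non-zero `m` on `G ⧸ G_γ` with the quotient integral formula), `exists_localOrbitalMeasure_of_forall_comm`
  (abelian `G_γ`), `exists_localOrbitalMeasure_isFiniteMeasureOnCompacts` (the phrasing «`SMulInvariantMeasure ∧ IsFiniteMeasureOnCompacts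
  ∧ ≠ 0`» under «`G_γ` unimodular»), and the anisotropic dress.  The centraliser's unimodularity is a HYPOTHESIS (true for semisimple
  `γ`: `G_γ` is reductive; not proved here).
* §3 (edition 2) the same in EVERY rank `N ≥ 3` (`exists_localOrbitalMeasure_of_three_le[_of_forall_comm]`, over ★
  `UnitaryGroupUnimodularAllRanks`).

## References
* J. Rogawski, *Automorphic Representations of Unitary Groups in Three Variables* (1990), §4.9 p. 54 (orbital integrals
  `Φ(γ, f)` over `G_γ \ G`) [Rogawski1990].
* A. Deitmar, S. Echterhoff, *Principles of Harmonic Analysis*, 2nd ed. (2014), Thm. 1.5.3 (invariant measures on `G/H`),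
  Lemma 9.3.3 (orbital integrals) [DeitmarEchterhoff2014].
* G. B. Folland, *A Course in Abstract Harmonic Analysis* (1995), Thm. 2.49 [Folland1995].
-/

noncomputable section

open MeasureTheory Measure NumberField IsDedekindDomain
open Literature.MeasureTheory.Group
open scoped Matrix NNReal

namespace Literature.NumberTheory.Automorphic

/-! ## §1 Invariant measures on `G ⧸ G_γ` (generic) -/

section Generic

variable {G : Type*} [Group G] [TopologicalSpace G] [IsTopologicalGroup G] [LocallyCompactSpace G]
  [SecondCountableTopology G] [T2Space G] [MeasurableSpace G] [BorelSpace G]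

omit [LocallyCompactSpace G] [SecondCountableTopology G] [MeasurableSpace G] [BorelSpace G] in
/-- The centraliser `G_γ` of an element of a Hausdorff topological group is closed (Mathlib `Set.isClosed_centralizer`).
[cite: DeitmarEchterhoff2014, Lemma 9.3.3] -/
theorem isClosed_coe_centralizer_singleton (γ : G) : IsClosed ((Subgroup.centralizer ({γ} : Set G)) : Set G) :=
  Set.isClosed_centralizer ({γ} : Set G)

omit [T2Space G] [MeasurableSpace G] [BorelSpace G] in
/-- **A closed subgroup whose elements commute is unimodular**: every Haar measure on it is right invariant (each element is
central, so `Δ ≡ 1`, ★ `modularCharacter_eq_one_of_mem_center`; ★ `isMulRightInvariant_of_modularCharacterFun_eq_one`).  The case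
of the centraliser of a regular semisimple element (a torus). [cite: Folland1995, Thm. 2.49] -/
theorem isMulRightInvariant_of_forall_comm (M : Subgroup G) (hM : IsClosed (M : Set G))
    (hcomm : ∀ a ∈ M, ∀ b ∈ M, a * b = b * a) [MeasurableSpace M] [BorelSpace M] (ρ : Measure M) [IsHaarMeasure ρ] :
    ρ.IsMulRightInvariant := by
  haveI : LocallyCompactSpace M := hM.isClosedEmbedding_subtypeVal.locallyCompactSpace
  haveI : SecondCountableTopology M := TopologicalSpace.Subtype.secondCountableTopology _
  refine isMulRightInvariant_of_modularCharacterFun_eq_one (fun g => ?_) ρ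
  exact modularCharacter_eq_one_of_mem_center
    (Subgroup.mem_center_iff.2 fun h => Subtype.ext (hcomm _ h.2 _ g.2))

/-- **The invariant measure on `G ⧸ G_γ` with its quotient integral formula** (Deitmar–Echterhoff, Thm. 1.5.3, unimodular case):
for `G` locally compact second countable Hausdorff, `γ ∈ G`, a Haar measure `ν` on `G` which is right invariant and a Haar measure
`ρ` on the centraliser `G_γ` which is inversion invariant, there is a `G`-invariant regular measure `m ≠ 0` on `G ⧸ G_γ` with
`∫_{G ⧸ G_γ} (∫_{G_γ} f(x h) dρ(h)) dm(x G_γ) = ∫_G f dν` for every `f ∈ C_c(G, ℝ)` — the measure `dẋ` of the orbital integrals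
`∫_{G_γ \ G} f(x⁻¹ γ x) dẋ` (★ `quotientMeasure`). [cite: DeitmarEchterhoff2014, Thm. 1.5.3] [cite: Rogawski1990, §4.9 p. 54] -/
theorem exists_smulInvariantMeasure_quotient_centralizer (γ : G) (ν : Measure G) [IsHaarMeasure ν] [ν.IsMulRightInvariant]
    [MeasurableSpace (Subgroup.centralizer ({γ} : Set G))] [BorelSpace (Subgroup.centralizer ({γ} : Set G))]
    (ρ : Measure (Subgroup.centralizer ({γ} : Set G))) [IsHaarMeasure ρ] [ρ.IsInvInvariant]
    [MeasurableSpace (G ⧸ Subgroup.centralizer ({γ} : Set G))] [BorelSpace (G ⧸ Subgroup.centralizer ({γ} : Set G))] :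
    ∃ m : Measure (G ⧸ Subgroup.centralizer ({γ} : Set G)),
      SMulInvariantMeasure G (G ⧸ Subgroup.centralizer ({γ} : Set G)) m ∧ m.Regular ∧ m ≠ 0 ∧
        ∀ f : CompactlySupportedContinuousMap G ℝ,
          ∫ x, fiberIntegral (Subgroup.centralizer ({γ} : Set G)) ρ f x ∂m = ∫ g, f g ∂ν := by
  haveI : LocallyCompactSpace (Subgroup.centralizer ({γ} : Set G)) :=
    (isClosed_coe_centralizer_singleton γ).isClosedEmbedding_subtypeVal.locallyCompactSpace
  haveI : SecondCountableTopology (Subgroup.centralizer ({γ} : Set G)) := TopologicalSpace.Subtype.secondCountableTopology _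
  exact exists_smulInvariantMeasure_integral_fiberIntegral_eq (Subgroup.centralizer ({γ} : Set G)) ρ
    (isClosed_coe_centralizer_singleton γ) ν

/-- The same for an ABELIAN centraliser (regular semisimple `γ`): then every Haar measure `ρ` on `G_γ` is right invariant
(`isMulRightInvariant_of_forall_comm`) and inversion invariant (★ `isInvInvariant_of_isMulRightInvariant`), so no hypothesis on `ρ`
is needed. [cite: DeitmarEchterhoff2014, Thm. 1.5.3] -/
theorem exists_smulInvariantMeasure_quotient_centralizer_of_forall_comm (γ : G)
    (hcomm : ∀ a ∈ Subgroup.centralizer ({γ} : Set G), ∀ b ∈ Subgroup.centralizer ({γ} : Set G), a * b = b * a)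
    (ν : Measure G) [IsHaarMeasure ν] [ν.IsMulRightInvariant]
    [MeasurableSpace (Subgroup.centralizer ({γ} : Set G))] [BorelSpace (Subgroup.centralizer ({γ} : Set G))]
    (ρ : Measure (Subgroup.centralizer ({γ} : Set G))) [IsHaarMeasure ρ]
    [MeasurableSpace (G ⧸ Subgroup.centralizer ({γ} : Set G))] [BorelSpace (G ⧸ Subgroup.centralizer ({γ} : Set G))] :
    ∃ m : Measure (G ⧸ Subgroup.centralizer ({γ} : Set G)),
      SMulInvariantMeasure G (G ⧸ Subgroup.centralizer ({γ} : Set G)) m ∧ m.Regular ∧ m ≠ 0 ∧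
        ∀ f : CompactlySupportedContinuousMap G ℝ,
          ∫ x, fiberIntegral (Subgroup.centralizer ({γ} : Set G)) ρ f x ∂m = ∫ g, f g ∂ν := by
  haveI : LocallyCompactSpace (Subgroup.centralizer ({γ} : Set G)) :=
    (isClosed_coe_centralizer_singleton γ).isClosedEmbedding_subtypeVal.locallyCompactSpace
  haveI : SecondCountableTopology (Subgroup.centralizer ({γ} : Set G)) := TopologicalSpace.Subtype.secondCountableTopology _
  haveI := isMulRightInvariant_of_forall_comm (Subgroup.centralizer ({γ} : Set G)) (isClosed_coe_centralizer_singleton γ) hcomm ρ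
  haveI : ρ.IsInvInvariant := isInvInvariant_of_isMulRightInvariant ρ
  exact exists_smulInvariantMeasure_quotient_centralizer γ ν ρ

end Generic

/-! ## §2 The local unitary groups `U(H)(L⁺_v)` (rank 3): the orbital measure exists for every Haar normalisation -/

namespace UnitaryGroup

section CM

variable (L : Type) [Field L] [NumberField L] [IsCMField L]

/-- **The measure of the local orbital integrals on `U(H)(L⁺_v)` exists.**  For `H ∈ M₃(L)` hermitian with `det H ≠ 0`, a finite
place `v` of `L⁺`, `γ ∈ G = U(H)(L⁺_v) = (cmDatum L 3 H).Local v`, ANY Haar measure `ν` on `G` (automatically right invariant: `G` is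
unimodular, ★ `isMulRightInvariant_cmDatum_local_three`) and any inversion-invariant Haar measure `ρ` on the centraliser `G_γ`
(hypothesis «`G_γ` unimodular»): there is a `G`-invariant regular measure `m ≠ 0` on `G ⧸ G_γ` with the quotient integral formula
`∫_{G ⧸ G_γ} ∫_{G_γ} f(x h) dρ dm = ∫_G f dν` — the measure `dẋ` of `Φ(γ, f_v) = ∫_{G_γ \ G} f_v(x⁻¹ γ x) dẋ` [Rogawski1990, §4.9].
[cite: Rogawski1990, §4.9 p. 54] [cite: DeitmarEchterhoff2014, Thm. 1.5.3] -/
theorem exists_localOrbitalMeasure (H : Matrix (Fin 3) (Fin 3) L) (hH : (H.map (cmConjRingHom L))ᵀ = H) (hdet : H.det ≠ 0)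
    (v : HeightOneSpectrum (𝓞 ↥(maximalRealSubfield L))) (γ : (cmDatum L 3 H).Local v)
    [MeasurableSpace ((cmDatum L 3 H).Local v)] [BorelSpace ((cmDatum L 3 H).Local v)]
    (ν : Measure ((cmDatum L 3 H).Local v)) [IsHaarMeasure ν]
    [MeasurableSpace (Subgroup.centralizer ({γ} : Set ((cmDatum L 3 H).Local v)))]
    [BorelSpace (Subgroup.centralizer ({γ} : Set ((cmDatum L 3 H).Local v)))]
    (ρ : Measure (Subgroup.centralizer ({γ} : Set ((cmDatum L 3 H).Local v)))) [IsHaarMeasure ρ] [ρ.IsInvInvariant]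
    [MeasurableSpace ((cmDatum L 3 H).Local v ⧸ Subgroup.centralizer ({γ} : Set ((cmDatum L 3 H).Local v)))]
    [BorelSpace ((cmDatum L 3 H).Local v ⧸ Subgroup.centralizer ({γ} : Set ((cmDatum L 3 H).Local v)))] :
    ∃ m : Measure ((cmDatum L 3 H).Local v ⧸ Subgroup.centralizer ({γ} : Set ((cmDatum L 3 H).Local v))),
      SMulInvariantMeasure ((cmDatum L 3 H).Local v) _ m ∧ m.Regular ∧ m ≠ 0 ∧
        ∀ f : CompactlySupportedContinuousMap ((cmDatum L 3 H).Local v) ℝ,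
          ∫ x, fiberIntegral (Subgroup.centralizer ({γ} : Set ((cmDatum L 3 H).Local v))) ρ f x ∂m = ∫ g, f g ∂ν := by
  haveI := isMulRightInvariant_cmDatum_local_three L H hH hdet v ν
  exact exists_smulInvariantMeasure_quotient_centralizer γ ν ρ

/-- **Abelian centraliser** (regular semisimple `γ`): the orbital measure on `U(H)(L⁺_v) ⧸ G_γ` exists for EVERY pair of Haar
measures `ν` on `G`, `ρ` on `G_γ` (no invariance hypotheses left). [cite: Rogawski1990, §4.9 p. 54] [cite: DeitmarEchterhoff2014, Thm. 1.5.3] -/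
theorem exists_localOrbitalMeasure_of_forall_comm (H : Matrix (Fin 3) (Fin 3) L) (hH : (H.map (cmConjRingHom L))ᵀ = H)
    (hdet : H.det ≠ 0) (v : HeightOneSpectrum (𝓞 ↥(maximalRealSubfield L))) (γ : (cmDatum L 3 H).Local v)
    (hcomm : ∀ a ∈ Subgroup.centralizer ({γ} : Set ((cmDatum L 3 H).Local v)),
      ∀ b ∈ Subgroup.centralizer ({γ} : Set ((cmDatum L 3 H).Local v)), a * b = b * a)
    [MeasurableSpace ((cmDatum L 3 H).Local v)] [BorelSpace ((cmDatum L 3 H).Local v)]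
    (ν : Measure ((cmDatum L 3 H).Local v)) [IsHaarMeasure ν]
    [MeasurableSpace (Subgroup.centralizer ({γ} : Set ((cmDatum L 3 H).Local v)))]
    [BorelSpace (Subgroup.centralizer ({γ} : Set ((cmDatum L 3 H).Local v)))]
    (ρ : Measure (Subgroup.centralizer ({γ} : Set ((cmDatum L 3 H).Local v)))) [IsHaarMeasure ρ]
    [MeasurableSpace ((cmDatum L 3 H).Local v ⧸ Subgroup.centralizer ({γ} : Set ((cmDatum L 3 H).Local v)))]
    [BorelSpace ((cmDatum L 3 H).Local v ⧸ Subgroup.centralizer ({γ} : Set ((cmDatum L 3 H).Local v)))] :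
    ∃ m : Measure ((cmDatum L 3 H).Local v ⧸ Subgroup.centralizer ({γ} : Set ((cmDatum L 3 H).Local v))),
      SMulInvariantMeasure ((cmDatum L 3 H).Local v) _ m ∧ m.Regular ∧ m ≠ 0 ∧
        ∀ f : CompactlySupportedContinuousMap ((cmDatum L 3 H).Local v) ℝ,
          ∫ x, fiberIntegral (Subgroup.centralizer ({γ} : Set ((cmDatum L 3 H).Local v))) ρ f x ∂m = ∫ g, f g ∂ν := by
  haveI := isMulRightInvariant_cmDatum_local_three L H hH hdet v ν
  exact exists_smulInvariantMeasure_quotient_centralizer_of_forall_comm γ hcomm ν ρ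

/-- The phrasing «`G`-invariant, finite on compacts, non-zero» under «`G_γ` unimodular» (some Haar measure `ρ` on `G_γ` is right
invariant): the invariant Borel measure on `U(H)(L⁺_v) ⧸ G_γ` exists (★ `exists_smulInvariantMeasure_quotient_of_isMulRightInvariant`
with the unimodularity of `U(H)(L⁺_v)`, ★ O4). [cite: DeitmarEchterhoff2014, Thm. 1.5.3] [cite: Rogawski1990, §4.9 p. 54] -/
theorem exists_localOrbitalMeasure_isFiniteMeasureOnCompacts (H : Matrix (Fin 3) (Fin 3) L)
    (hH : (H.map (cmConjRingHom L))ᵀ = H) (hdet : H.det ≠ 0) (v : HeightOneSpectrum (𝓞 ↥(maximalRealSubfield L)))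
    (γ : (cmDatum L 3 H).Local v)
    [MeasurableSpace ((cmDatum L 3 H).Local v)] [BorelSpace ((cmDatum L 3 H).Local v)]
    (ν : Measure ((cmDatum L 3 H).Local v)) [IsHaarMeasure ν]
    [MeasurableSpace (Subgroup.centralizer ({γ} : Set ((cmDatum L 3 H).Local v)))]
    [BorelSpace (Subgroup.centralizer ({γ} : Set ((cmDatum L 3 H).Local v)))]
    (ρ : Measure (Subgroup.centralizer ({γ} : Set ((cmDatum L 3 H).Local v)))) [IsHaarMeasure ρ] [ρ.IsMulRightInvariant]
    [MeasurableSpace ((cmDatum L 3 H).Local v ⧸ Subgroup.centralizer ({γ} : Set ((cmDatum L 3 H).Local v)))]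
    [BorelSpace ((cmDatum L 3 H).Local v ⧸ Subgroup.centralizer ({γ} : Set ((cmDatum L 3 H).Local v)))] :
    ∃ m : Measure ((cmDatum L 3 H).Local v ⧸ Subgroup.centralizer ({γ} : Set ((cmDatum L 3 H).Local v))),
      SMulInvariantMeasure ((cmDatum L 3 H).Local v) _ m ∧ IsFiniteMeasureOnCompacts m ∧ m ≠ 0 := by
  haveI := isMulRightInvariant_cmDatum_local_three L H hH hdet v ν
  exact exists_smulInvariantMeasure_quotient_of_isMulRightInvariant
    (Subgroup.centralizer ({γ} : Set ((cmDatum L 3 H).Local v))) (isClosed_coe_centralizer_singleton γ) ρ ν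

/-- Anisotropic dress (the binders of the quasi-split comparison; `det H ≠ 0` by ★ `Godement.det_ne_zero_of_anisotropic`): the
orbital measure on `U(H)(L⁺_v) ⧸ G_γ` with the quotient integral formula, `G_γ` unimodular.
[cite: Rogawski1990, §4.9 p. 54] [cite: DeitmarEchterhoff2014, Thm. 1.5.3] -/
theorem exists_localOrbitalMeasure_of_anisotropic (H : Matrix (Fin 3) (Fin 3) L)
    (hanis : ∀ x : Fin 3 → L, Literature.AlgebraicGeometry.ShimuraVarieties.hermForm (cmConjRingHom L) H x x = 0 → x = 0)
    (hH : (H.map (cmConjRingHom L))ᵀ = H) (v : HeightOneSpectrum (𝓞 ↥(maximalRealSubfield L))) (γ : (cmDatum L 3 H).Local v)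
    [MeasurableSpace ((cmDatum L 3 H).Local v)] [BorelSpace ((cmDatum L 3 H).Local v)]
    (ν : Measure ((cmDatum L 3 H).Local v)) [IsHaarMeasure ν]
    [MeasurableSpace (Subgroup.centralizer ({γ} : Set ((cmDatum L 3 H).Local v)))]
    [BorelSpace (Subgroup.centralizer ({γ} : Set ((cmDatum L 3 H).Local v)))]
    (ρ : Measure (Subgroup.centralizer ({γ} : Set ((cmDatum L 3 H).Local v)))) [IsHaarMeasure ρ] [ρ.IsInvInvariant]
    [MeasurableSpace ((cmDatum L 3 H).Local v ⧸ Subgroup.centralizer ({γ} : Set ((cmDatum L 3 H).Local v)))]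
    [BorelSpace ((cmDatum L 3 H).Local v ⧸ Subgroup.centralizer ({γ} : Set ((cmDatum L 3 H).Local v)))] :
    ∃ m : Measure ((cmDatum L 3 H).Local v ⧸ Subgroup.centralizer ({γ} : Set ((cmDatum L 3 H).Local v))),
      SMulInvariantMeasure ((cmDatum L 3 H).Local v) _ m ∧ m.Regular ∧ m ≠ 0 ∧
        ∀ f : CompactlySupportedContinuousMap ((cmDatum L 3 H).Local v) ℝ,
          ∫ x, fiberIntegral (Subgroup.centralizer ({γ} : Set ((cmDatum L 3 H).Local v))) ρ f x ∂m = ∫ g, f g ∂ν :=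
  exists_localOrbitalMeasure L H hH (Godement.det_ne_zero_of_anisotropic L H hanis) v γ ν ρ

end CM

/-! ## §3 (edition 2) Every rank `N ≥ 3` -/

section AllRanks

variable (L : Type) [Field L] [NumberField L] [IsCMField L] {N : ℕ}

/-- **The measure of the local orbital integrals on `U(H)(L⁺_v)` exists in every rank `N ≥ 3`** (edition 2; §2 is the rank-3 statement):
for `H ∈ M_N(L)` hermitian with `det H ≠ 0`, `γ ∈ G = (cmDatum L N H).Local v`, ANY Haar measure `ν` on `G` (right invariant by ★
`isMulRightInvariant_cmDatum_local_of_three_le`) and any inversion-invariant Haar `ρ` on `G_γ`: a `G`-invariant regular measure `m ≠ 0`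
on `G ⧸ G_γ` with `∫_{G ⧸ G_γ} ∫_{G_γ} f(x h) dρ dm = ∫_G f dν`. [cite: Rogawski1990, §4.9 p. 54] [cite: DeitmarEchterhoff2014, Thm. 1.5.3] -/
theorem exists_localOrbitalMeasure_of_three_le (hN : 3 ≤ N) (H : Matrix (Fin N) (Fin N) L)
    (hH : (H.map (cmConjRingHom L))ᵀ = H) (hdet : H.det ≠ 0) (v : HeightOneSpectrum (𝓞 ↥(maximalRealSubfield L)))
    (γ : (cmDatum L N H).Local v)
    [MeasurableSpace ((cmDatum L N H).Local v)] [BorelSpace ((cmDatum L N H).Local v)]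
    (ν : Measure ((cmDatum L N H).Local v)) [IsHaarMeasure ν]
    [MeasurableSpace (Subgroup.centralizer ({γ} : Set ((cmDatum L N H).Local v)))]
    [BorelSpace (Subgroup.centralizer ({γ} : Set ((cmDatum L N H).Local v)))]
    (ρ : Measure (Subgroup.centralizer ({γ} : Set ((cmDatum L N H).Local v)))) [IsHaarMeasure ρ] [ρ.IsInvInvariant]
    [MeasurableSpace ((cmDatum L N H).Local v ⧸ Subgroup.centralizer ({γ} : Set ((cmDatum L N H).Local v)))]
    [BorelSpace ((cmDatum L N H).Local v ⧸ Subgroup.centralizer ({γ} : Set ((cmDatum L N H).Local v)))] :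
    ∃ m : Measure ((cmDatum L N H).Local v ⧸ Subgroup.centralizer ({γ} : Set ((cmDatum L N H).Local v))),
      SMulInvariantMeasure ((cmDatum L N H).Local v) _ m ∧ m.Regular ∧ m ≠ 0 ∧
        ∀ f : CompactlySupportedContinuousMap ((cmDatum L N H).Local v) ℝ,
          ∫ x, fiberIntegral (Subgroup.centralizer ({γ} : Set ((cmDatum L N H).Local v))) ρ f x ∂m = ∫ g, f g ∂ν := by
  haveI := isMulRightInvariant_cmDatum_local_of_three_le L hN H hH hdet v ν
  exact exists_smulInvariantMeasure_quotient_centralizer γ ν ρ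

/-- Every rank `N ≥ 3`, ABELIAN centraliser (regular semisimple `γ`): no hypothesis on `ρ`. [cite: Rogawski1990, §4.9 p. 54]
[cite: DeitmarEchterhoff2014, Thm. 1.5.3] -/
theorem exists_localOrbitalMeasure_of_three_le_of_forall_comm (hN : 3 ≤ N) (H : Matrix (Fin N) (Fin N) L)
    (hH : (H.map (cmConjRingHom L))ᵀ = H) (hdet : H.det ≠ 0) (v : HeightOneSpectrum (𝓞 ↥(maximalRealSubfield L)))
    (γ : (cmDatum L N H).Local v)
    (hcomm : ∀ a ∈ Subgroup.centralizer ({γ} : Set ((cmDatum L N H).Local v)),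
      ∀ b ∈ Subgroup.centralizer ({γ} : Set ((cmDatum L N H).Local v)), a * b = b * a)
    [MeasurableSpace ((cmDatum L N H).Local v)] [BorelSpace ((cmDatum L N H).Local v)]
    (ν : Measure ((cmDatum L N H).Local v)) [IsHaarMeasure ν]
    [MeasurableSpace (Subgroup.centralizer ({γ} : Set ((cmDatum L N H).Local v)))]
    [BorelSpace (Subgroup.centralizer ({γ} : Set ((cmDatum L N H).Local v)))]
    (ρ : Measure (Subgroup.centralizer ({γ} : Set ((cmDatum L N H).Local v)))) [IsHaarMeasure ρ]
    [MeasurableSpace ((cmDatum L N H).Local v ⧸ Subgroup.centralizer ({γ} : Set ((cmDatum L N H).Local v)))]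
    [BorelSpace ((cmDatum L N H).Local v ⧸ Subgroup.centralizer ({γ} : Set ((cmDatum L N H).Local v)))] :
    ∃ m : Measure ((cmDatum L N H).Local v ⧸ Subgroup.centralizer ({γ} : Set ((cmDatum L N H).Local v))),
      SMulInvariantMeasure ((cmDatum L N H).Local v) _ m ∧ m.Regular ∧ m ≠ 0 ∧
        ∀ f : CompactlySupportedContinuousMap ((cmDatum L N H).Local v) ℝ,
          ∫ x, fiberIntegral (Subgroup.centralizer ({γ} : Set ((cmDatum L N H).Local v))) ρ f x ∂m = ∫ g, f g ∂ν := by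
  haveI := isMulRightInvariant_cmDatum_local_of_three_le L hN H hH hdet v ν
  exact exists_smulInvariantMeasure_quotient_centralizer_of_forall_comm γ hcomm ν ρ

end AllRanks

end UnitaryGroup

end Literature.NumberTheory.Automorphic

end
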